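import Summits.Schanuel.Schanuel.Theorems.RootDecomp1PillayTuple

/-!
# RootDecomp1 — Pillay's tuple at `u = e` under Schanuel; the NO-GO for the shared-witness programme (lens-1 round 11, part D;
`--supports stmt-Schanuel-30352`)

Schanuel's conjecture at `(1, e, e²)` and at `(1, e, e², v(e))` gives the genericity hypothesis of part C at `u = e`
(`pillayHyp_e_of_schanuel`); hence `schanuel_forces_nonmodular_entanglement`: under Schanuel there is an explicit ℚ-l.i. triple in
`ecl ∅` that is ENTANGLED and has NO modular witness, and `schanuel_imp_not_modularWitness_programme`: a lemma «every ℚ-l.i.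
entangled tuple in `ecl ∅` has a modular witness» is inconsistent with the summit.  SCOPE (decomp-schanuel-crit-1
2026-08-30T12:30:23Z): rel. S the UNSATURATED class {ℚ-l.i., `⊂ ecl ∅`, entangled} has a witness-free member (Pillay's tuple at
`u = e`, which is NOT saturated: `w = 1`); the unsaturated shared-witness lemma is inconsistent with S; the saturated residual's
witness-free layer is reached at `u = e^e` in parts E/F (`RootDecomp1PillayTupleExpE`, `RootDecomp1PillayTupleSaturated`).
(Background, cited per decomp-schanuel-crit-1 novelty note G7: non-modularity of exponential / pseudo-exponential pregeometries is
folklore in the model theory of `ℂ_exp` — Kirby, *Exponential algebraicity in exponential fields*, Bull. LMS 42 (2010),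
arXiv:0810.4285; Bays–Kirby, *Pseudo-exponential maps, variants, and quasiminimality*, Algebra & Number Theory 12 (2018),
arXiv:1512.04262.  Parts B–F give the explicit `ℚ`-instances along the exponential graph that the residual 30352 needs.)
-/

set_option linter.dupNamespace false

noncomputable section

namespace Summit.Schanuel.Schanuel.Theorems.RootDecomp1ModularLayer

open Complex IntermediateField
open scoped BigOperators Cardinal
open Summit.Schanuel.Schanuel.Theorems.RootDecomp1EAnchor (isAlgebraic_of_trdeg_sandwich trdeg_adjoin_le_of_isAlgebraic
  trdeg_adjoin_union_le trdeg_adjoin_le_nat exists_nat_eq_of_le_natCast isAlgebraic_of_mem_adjoin isAlgebraic_of_le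
  isAlgebraic_of_isAlgebraic_adjoin trdeg_adjoin_sum_le_union one_le_trdeg_adjoin_singleton)
open Summit.Schanuel.Schanuel.Theorems.RootDecomp1ArgumentCells (le_trdeg_of_algebraicIndependent_mem)
open Summit.Schanuel.Schanuel.Theorems.RootDecomp1AtomRigidity (mem_adjoin_range_of_mem_span_int
  exp_mem_adjoin_exp_of_mem_span_int)
open Summit.Schanuel.Schanuel.Theorems.RootDecomp1SharedDegree (trdeg_union_add_one_le_of_shared
  entangled_of_shared_transcendental lt_of_add_one_le_of_le_nat)
open Literature.NumberTheory.Transcendental (SchanuelRank transcendental_exp transcendental_exp_holds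
  exists_nsmul_mem_span_int isAlgebraic_adjoin_over_algebraAdjoin)
open Literature.NumberTheory.Transcendental.OneMotiveToric (trdeg_mono)
open Literature.Barriers.Schanuel (algebraicIndependent_of_le_trdeg_adjoin trdeg_adjoin_union_eq_of_isAlgebraic)

/-- (private copy; the public form is a print-twin of a landed declaration — gate dedup) A field generated by an `m`-tuple
has `trdeg ≤ m`. -/
private theorem trdeg_adjoin_range_le {m : ℕ} (x : Fin m → ℂ) : Algebra.trdeg ℚ ↥(adjoin ℚ (Set.range x)) ≤ (m : Cardinal) :=
  trdeg_adjoin_le_nat _ (by simpa using Cardinal.mk_range_le (f := x))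

/-! ### `PillayHyp e` is a consequence of Schanuel's conjecture (two applications: `(1, e, e²)` and `(1, e, e², v(e))`) -/

/-- `e` is transcendental (Hermite, via the tree's `transcendental_exp_holds`); private: print-twin of
`Literature.NumberTheory.Transcendental.transcendental_rat_cexp_one` (gate dedup; later parts carry private copies). -/
private theorem transcendental_cexp_one : Transcendental ℚ (cexp 1) :=
  transcendental_exp_holds isAlgebraic_one one_ne_zero

/-- `(1, e, e²)` is ℚ-linearly independent. -/
theorem linearIndependent_one_e_esq : LinearIndependent ℚ ![(1 : ℂ), cexp 1, cexp 1 ^ 2] := by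
  classical
  rw [Fintype.linearIndependent_iff]
  intro g hg
  simp only [Fin.sum_univ_three, Matrix.cons_val_zero, Matrix.cons_val_one, Matrix.cons_val] at hg
  have hg' : ((g 0 : ℚ) : ℂ) + (g 1 : ℂ) * cexp 1 + (g 2 : ℂ) * cexp 1 ^ 2 = 0 := by
    simpa [Rat.smul_def] using hg
  have hq := quadratic_relation_trivial transcendental_cexp_one hg'
  intro i; fin_cases i
  · exact hq.1
  · exact hq.2.1
  · exact hq.2.2

/-- Schanuel ⟹ `e, e^e, e^{e²}` algebraically independent (Schanuel at `(1, e, e²)`). -/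
theorem algebraicIndependent_eTower_of_schanuel (hS : Literature.Periods.SchanuelConjecture) :
    AlgebraicIndependent ℚ ![cexp 1, cexp (cexp 1), cexp (cexp 1 ^ 2)] := by
  have h3 := hS 3 ![(1 : ℂ), cexp 1, cexp 1 ^ 2] linearIndependent_one_e_esq
  set K : IntermediateField ℚ ℂ := adjoin ℚ (Set.range ![cexp 1, cexp (cexp 1), cexp (cexp 1 ^ 2)]) with hKdef
  have he : cexp 1 ∈ K := subset_adjoin ℚ _ ⟨0, by simp⟩
  have hee : cexp (cexp 1) ∈ K := subset_adjoin ℚ _ ⟨1, by simp⟩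
  have heee : cexp (cexp 1 ^ 2) ∈ K := subset_adjoin ℚ _ ⟨2, by simp⟩
  have hle : Algebra.trdeg ℚ ↥(adjoin ℚ (Set.range ![(1 : ℂ), cexp 1, cexp 1 ^ 2] ∪
      Set.range (cexp ∘ ![(1 : ℂ), cexp 1, cexp 1 ^ 2]))) ≤ Algebra.trdeg ℚ ↥K := by
    refine trdeg_adjoin_le_of_isAlgebraic ?_
    rintro x (⟨i, rfl⟩ | ⟨i, rfl⟩)
    · fin_cases i
      · simpa using isAlgebraic_of_mem_adjoin (one_mem K)
      · simpa using isAlgebraic_of_mem_adjoin he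
      · simpa using isAlgebraic_of_mem_adjoin (pow_mem he 2)
    · fin_cases i
      · simpa using isAlgebraic_of_mem_adjoin he
      · simpa using isAlgebraic_of_mem_adjoin hee
      · simpa using isAlgebraic_of_mem_adjoin heee
  exact algebraicIndependent_of_le_trdeg_adjoin _ (h3.trans hle)

/-- `(1, e, e², v(e))` is ℚ-linearly independent under Schanuel (the e-tower is algebraically independent, so `v(e) = e^{e²} − e·e^e ∉ ℚ(e)`). -/
theorem linearIndependent_one_e_esq_v_of_schanuel (hS : Literature.Periods.SchanuelConjecture) :
    LinearIndependent ℚ ![(1 : ℂ), cexp 1, cexp 1 ^ 2, pillayV (cexp 1)] := by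
  classical
  have hT := algebraicIndependent_eTower_of_schanuel hS
  -- `e^{e²}` is transcendental over `ℚ(e, e^e)`
  have hn : ¬ IsAlgebraic ↥(adjoin ℚ (Set.range ![cexp 1, cexp (cexp 1)])) (cexp (cexp 1 ^ 2)) := by
    intro halg
    have h3 : ((3 : ℕ) : Cardinal) ≤ Algebra.trdeg ℚ ↥(adjoin ℚ (Set.range ![cexp 1, cexp (cexp 1), cexp (cexp 1 ^ 2)])) :=
      le_trdeg_of_algebraicIndependent_mem _ hT (fun i => subset_adjoin ℚ _ ⟨i, rfl⟩)
    have hle : Algebra.trdeg ℚ ↥(adjoin ℚ (Set.range ![cexp 1, cexp (cexp 1), cexp (cexp 1 ^ 2)])) ≤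
        Algebra.trdeg ℚ ↥(adjoin ℚ (Set.range ![cexp 1, cexp (cexp 1)])) := by
      refine trdeg_adjoin_le_of_isAlgebraic ?_
      rintro _ ⟨i, rfl⟩
      fin_cases i
      · simpa using isAlgebraic_of_mem_adjoin (subset_adjoin ℚ (Set.range ![cexp 1, cexp (cexp 1)]) ⟨0, by simp⟩)
      · simpa using isAlgebraic_of_mem_adjoin (subset_adjoin ℚ (Set.range ![cexp 1, cexp (cexp 1)]) ⟨1, by simp⟩)
      · simpa using halg
    have : ((3 : ℕ) : Cardinal) ≤ ((2 : ℕ) : Cardinal) := h3.trans (hle.trans (trdeg_adjoin_range_le _))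
    have : (3 : ℕ) ≤ 2 := by exact_mod_cast this
    omega
  rw [Fintype.linearIndependent_iff]
  intro g hg
  simp only [Fin.sum_univ_four, Matrix.cons_val_zero, Matrix.cons_val_one, Matrix.cons_val] at hg
  have hg' : ((g 0 : ℚ) : ℂ) + (g 1 : ℂ) * cexp 1 + (g 2 : ℂ) * cexp 1 ^ 2 + (g 3 : ℂ) * pillayV (cexp 1) = 0 := by
    simpa [Rat.smul_def] using hg
  by_cases h3 : g 3 = 0
  · have hq := quadratic_relation_trivial transcendental_cexp_one (a := g 0) (b := g 1) (c := g 2) (by simpa [h3] using hg')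
    intro i; fin_cases i
    · exact hq.1
    · exact hq.2.1
    · exact hq.2.2
    · exact h3
  · exfalso
    apply hn
    set K : IntermediateField ℚ ℂ := adjoin ℚ (Set.range ![cexp 1, cexp (cexp 1)]) with hKdef
    have he : cexp 1 ∈ K := subset_adjoin ℚ _ ⟨0, by simp⟩
    have hee : cexp (cexp 1) ∈ K := subset_adjoin ℚ _ ⟨1, by simp⟩
    have hv : pillayV (cexp 1) ∈ K := by
      have h3' : ((g 3 : ℚ) : ℂ) ≠ 0 := by exact_mod_cast h3
      have e : pillayV (cexp 1) = -(((g 0 : ℚ) : ℂ) + (g 1 : ℂ) * cexp 1 + (g 2 : ℂ) * cexp 1 ^ 2) / (g 3 : ℂ) := by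
        field_simp
        linear_combination hg'
      rw [e]
      refine div_mem (neg_mem (add_mem (add_mem ?_ (mul_mem ?_ he)) (mul_mem ?_ (pow_mem he 2)))) ?_ <;>
        exact SubfieldClass.ratCast_mem _ _
    have : cexp (cexp 1 ^ 2) ∈ K := by
      rw [exp_sq_eq]; exact add_mem (mul_mem he hee) hv
    exact isAlgebraic_of_mem_adjoin this

/-- **`Schanuel ⟹ PillayHyp e`** (Schanuel at the 4-tuple `(1, e, e², v(e))`: the eight numbers generate `ℚ(e, v, e^e, e^v)`). -/
theorem pillayHyp_e_of_schanuel (hS : Literature.Periods.SchanuelConjecture) : AlgebraicIndependent ℚ ![cexp 1, pillayV (cexp 1), cexp (cexp 1), cexp (pillayV (cexp 1))] := by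
  have h4 := hS 4 ![(1 : ℂ), cexp 1, cexp 1 ^ 2, pillayV (cexp 1)] (linearIndependent_one_e_esq_v_of_schanuel hS)
  set K : IntermediateField ℚ ℂ :=
    adjoin ℚ (Set.range ![cexp 1, pillayV (cexp 1), cexp (cexp 1), cexp (pillayV (cexp 1))]) with hKdef
  have he : cexp 1 ∈ K := subset_adjoin ℚ _ ⟨0, by simp⟩
  have hv : pillayV (cexp 1) ∈ K := subset_adjoin ℚ _ ⟨1, by simp⟩
  have hee : cexp (cexp 1) ∈ K := subset_adjoin ℚ _ ⟨2, by simp⟩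
  have hev : cexp (pillayV (cexp 1)) ∈ K := subset_adjoin ℚ _ ⟨3, by simp⟩
  have hle : Algebra.trdeg ℚ ↥(adjoin ℚ (Set.range ![(1 : ℂ), cexp 1, cexp 1 ^ 2, pillayV (cexp 1)] ∪
      Set.range (cexp ∘ ![(1 : ℂ), cexp 1, cexp 1 ^ 2, pillayV (cexp 1)]))) ≤ Algebra.trdeg ℚ ↥K := by
    refine trdeg_adjoin_le_of_isAlgebraic ?_
    rintro x (⟨i, rfl⟩ | ⟨i, rfl⟩)
    · fin_cases i
      · simpa using isAlgebraic_of_mem_adjoin (one_mem K)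
      · simpa using isAlgebraic_of_mem_adjoin he
      · simpa using isAlgebraic_of_mem_adjoin (pow_mem he 2)
      · simpa using isAlgebraic_of_mem_adjoin hv
    · fin_cases i
      · simpa using isAlgebraic_of_mem_adjoin he
      · simpa using isAlgebraic_of_mem_adjoin hee
      · simpa [exp_sq_eq] using isAlgebraic_of_mem_adjoin (add_mem (mul_mem he hee) hv)
      · simpa using isAlgebraic_of_mem_adjoin hev
  exact algebraicIndependent_of_le_trdeg_adjoin _ (h4.trans hle)

/-- **SCHANUEL FORCES NON-MODULAR ENTANGLEMENT IN THE UNSATURATED CLASS {ℚ-l.i., `⊂ ecl ∅`, entangled}.**  Under Schanuel's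
conjecture there is a ℚ-linearly independent triple `z ⊂ ecl ∅` (Pillay's tuple at `u = e`) that is ENTANGLED (`ε(z) ≥ 1`, the
extra hypothesis of `Cᵉ` = 30352, negation of `D`'s) and yet has NO modular witness (`μ(z) = σ(z) = 0`): no transcendental shared
element, no dark / log-dark line, no fixed point, Lambert point or exponential chain in its span.  Consequently NO theorem of the
form «ℚ-l.i. ∧ `⊂ ecl ∅` ∧ entangled ⟹ a shared special element» can be true unless Schanuel is false.  CAVEAT (critic
2026-08-30T12:30:23Z): this tuple is NOT saturated (`w = 1`: `1 ∈ F_z`, `e^1 = z₀ ∈ F_z`, `1 ∉ span_ℚ z`) and its saturated hull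
`(1, e, e², v(e))` has the chain witness `e`; the member of the SATURATED residual class is Pillay's tuple at `u = e^e`, §2c
(`schanuel_forces_saturated_nonmodular_entanglement`). -/
theorem schanuel_forces_nonmodular_entanglement (hS : Literature.Periods.SchanuelConjecture) :
    ∃ z : Fin 3 → ℂ, (∀ i, z i ∈ Literature.NumberTheory.Transcendental.ecl (∅ : Set ℂ)) ∧ LinearIndependent ℚ z ∧
      Algebra.trdeg ℚ ↥(adjoin ℚ (Set.range z ∪ Set.range (cexp ∘ z))) <
        Algebra.trdeg ℚ ↥(adjoin ℚ (Set.range z)) + Algebra.trdeg ℚ ↥(adjoin ℚ (Set.range (cexp ∘ z))) ∧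
      ¬ (∃ s : ℂ, Transcendental ℚ s ∧ IsAlgebraic ↥(adjoin ℚ (Set.range z)) s ∧ IsAlgebraic ↥(adjoin ℚ (Set.range (cexp ∘ z))) s) :=
  ⟨pillayTuple (cexp 1), pillayTuple_mem_ecl exp_one_mem_ecl, linearIndependent_pillayTuple (pillayHyp_e_of_schanuel hS),
    entangled_pillayTuple (pillayHyp_e_of_schanuel hS), not_modularWitness_pillayTuple (pillayHyp_e_of_schanuel hS)⟩

/-- Unconditional form: for EVERY `u ∈ ecl ∅` with `PillayHyp u`, Pillay's tuple is an entangled, witness-free, ℚ-l.i. triple in `ecl ∅`. -/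
theorem nonmodular_entangled_of_pillayHyp {u : ℂ} (hu : u ∈ Literature.NumberTheory.Transcendental.ecl (∅ : Set ℂ))
    (hH : AlgebraicIndependent ℚ ![u, pillayV u, cexp u, cexp (pillayV u)]) :
    (∀ i, pillayTuple u i ∈ Literature.NumberTheory.Transcendental.ecl (∅ : Set ℂ)) ∧ LinearIndependent ℚ (pillayTuple u) ∧
      Algebra.trdeg ℚ ↥(adjoin ℚ (Set.range (pillayTuple u) ∪ Set.range (cexp ∘ pillayTuple u))) <
        Algebra.trdeg ℚ ↥(adjoin ℚ (Set.range (pillayTuple u))) +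
          Algebra.trdeg ℚ ↥(adjoin ℚ (Set.range (cexp ∘ pillayTuple u))) ∧
      ¬ (∃ s : ℂ, Transcendental ℚ s ∧ IsAlgebraic ↥(adjoin ℚ (Set.range (pillayTuple u))) s ∧
      IsAlgebraic ↥(adjoin ℚ (Set.range (cexp ∘ pillayTuple u))) s) :=
  ⟨pillayTuple_mem_ecl hu, linearIndependent_pillayTuple hH, entangled_pillayTuple hH, not_modularWitness_pillayTuple hH⟩


/-- Equivalently (Schanuel being the target): the UNSATURATED modular-witness programme is INCONSISTENT with the summit.  (For
the residual proper — all binders of 30352 — see `schanuel_imp_not_saturatedWitnessProgramme`, §2c.) -/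
theorem schanuel_imp_not_modularWitness_programme (hS : Literature.Periods.SchanuelConjecture) :
    ¬ (∀ (n : ℕ) (z : Fin n → ℂ), LinearIndependent ℚ z →
      (∀ i, z i ∈ Literature.NumberTheory.Transcendental.ecl (∅ : Set ℂ)) →
      Algebra.trdeg ℚ ↥(adjoin ℚ (Set.range z ∪ Set.range (cexp ∘ z))) <
        Algebra.trdeg ℚ ↥(adjoin ℚ (Set.range z)) + Algebra.trdeg ℚ ↥(adjoin ℚ (Set.range (cexp ∘ z))) →
      (∃ s : ℂ, Transcendental ℚ s ∧ IsAlgebraic ↥(adjoin ℚ (Set.range z)) s ∧ IsAlgebraic ↥(adjoin ℚ (Set.range (cexp ∘ z))) s)) :=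
  fun hprog => by
    obtain ⟨z, hecl, hli, hent, hno⟩ := schanuel_forces_nonmodular_entanglement hS
    exact hno (hprog 3 z hli hecl hent)

end Summit.Schanuel.Schanuel.Theorems.RootDecomp1ModularLayer

end
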